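import Summits.SmoothPoincare4.SmoothPoincare4.Theses.CongruenceShadows
import HarnessLib
import HarnessLib.Audit

/-!
# Line `joint-levine-inclusion-exclusion` for crux `CongruenceShadows.NilpotentShadowsStandard` (stmt-SmoothPoincare4-14594)

Skeleton (crux-plan, round 1; idea card `Cruxes/NilpotentShadowsStandard/Ideas/joint-levine-inclusion-exclusion.md`,
triage r1-1/2/3: pass ×3, merge-partner `homology-cylinder-standardisation`). Line card:
`Cruxes/NilpotentShadowsStandard/Lines/joint-levine-inclusion-exclusion.md`.

**The line.** The crux is the level induction `ShadowStandardAt m K c → ShadowStandardAt m K (c+1)`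
(bad levels are an up-set, `Disproof.shadowStandardAt_mono`). Level `0` is the route's support item
`AbelianShadowStandard` (stub 1). For the step, transport `K` so that level `c` is standard ON THE
NOSE (`Kᵢ ⊔ γ = Nᵢ ⊔ γ`, `γ = γ_{c+2}S`; Iso-invariance, proved here: normality, free single
quotients of rank `g` and free pair quotients of rank `m+1` travel along `ψ⁻¹`). Then realise each
SINGLE next-level shadow `Kᵢ ⊔ γ'` (`γ' = γ_{c+3}S`) from `Nᵢ` by an automorphism `φᵢ` that is
INERT modulo `γ` (acts trivially on `S/γ_{c+2}S`, i.e. lies in the Johnson-filtration piece whose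
Johnson image is the degree-`(c+1)` data) — stub 2, "single Levine surjectivity from the Johnson
kernel", the one-handlebody statement; and GLUE the three inert realisers, whose pairs have the
level-`(c+1)` shadows of honest rank-`(m+1)` kernels (`Kᵢ ⊔ Kⱼ`), into one automorphism — stub 3,
the joint step. In Levine's coordinates (arXiv:math/0408310 §3: the level-`(c+1)` lifts of `Nᵢγ`
form a torsor under `Hom(Lᵢ, L_{c+2}(H/Lᵢ))`, genuine lifts sit in `D_{c+1}(H/Lᵢ)` = the target
of Levine's `J^L_{c+1}`, and inert automorphisms translate by `pᵢ ∘ τ_{c+1}`, Levine §4.1), stub 2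
reads `pᵢ(im τ_{c+1}) ⊇ {genuine single data}` and stub 3 reads
`⋂ᵢ (im τ + Zᵢ) = im τ + Z₀∩Z₁∩Z₂` on compatible data (`Zᵢ = ker pᵢ`, a content-Boolean family);
BOTH follow from the card's `ITJ_{c+1}` ("isotropic trees are Johnson") by the inclusion–exclusion
section `t = Σ sᵢ(uᵢ) − Σ mᵢⱼ` (card §Why 1; triage r1-2 Common 2, r1-3 (ii)). Known: degree 1
(Johnson `τ₁ = Λ³H`); odd degree `< g` (Levine Lemma 4.3: `im J_k ⊇ D̃_k(H') = D_k(H')`, k odd,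
`g > k`); degree 2 integrally at `g = 3, 6, 9` (triage r1-1 (C1), Levine Rmk 4.1); `g = 3`
rationally through degree 8 (r1-1 (C2), r1-2 Common 3). OPEN CORE: degree `≥ g` (no spare letter)
and the 2-primary part at even degree `≥ 4` (Levine's question after Rmk 4.1). No classification
theorem (Zieschang / Grigorchuk–Kurchanov, let alone the route's `WaldhausenPairs`) is used: the
stubs speak about honest kernels (`S/Q ≅ F_g`, `S/P ≅ F_{m+1}`), which is all the torsor calculus
needs (triage r1-1 sharpening of `TripleFromSingles`).

**Shape.** Three registered stubs `stub_levelZero`, `stub_singleJohnson`, `stub_jointGlue`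
(statements `AbelianShadowStandard`, `SingleJohnson`, `JointGlue`); the glue `levelStep` /
`shadowStandardAt_of_stubs` / `nilpotentShadowsStandard_of_stubs` is sorry-free, and
`NilpotentShadowsStandard_of : …CongruenceShadows.NilpotentShadowsStandard` (type literally the route
decl) applies it to the three stubs. Sorries ONLY inside `stub_*`.

**Disproof.lean honoured** (`Cruxes/NilpotentShadowsStandard/Disproof.lean`, cdisprove 2026-08-16):
`nilpotentShadowsStandard_false_without_trisection` — `IsGroupTrisection` is consumed at every level:
`normal`/`free_quotient` are the hypotheses of stub 2 (honest handlebody kernels), `free_pairQuotient`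
is the compatibility hypothesis of stub 3, and the whole structure (incl. `triple`, `PUnit`) feeds
stub 1 at level 0; `anyGroup_false_of_genusThreeTrisectionOfCyclic` — `PUnit` enters ONLY through
stub 1 (level 0): stubs 2–3 never mention the triple quotient (nilpotent
Nakayama: the triple axiom is empty above level 0), consistent with the disprover's finding that the
trivial group is load-bearing exactly at `c = 0`; `counterexample_shape` / `shadowStandardAt_mono` —
the line IS the matching induction on `c` (`shadowStandardAt_of_stubs`). No `-- Targets` stub kills yet.
LANDED NEGATIVE LEMMAS checked against (`Theorems/NilpotentShadowsStandard/Negative/LoadBearing.lean`,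
`…/Negative/Shape.lean` = the conclusive part of Disproof.lean): a scratch check importing `Negative.Shape`
next to this file elaborates `Negative.shadow_mono h hc : ShadowStandardAt m K c'` and
`Negative.nilpotentShadowsStandard_false_without_trisection : ¬ ∀ m K c, ShadowStandardAt m K c` verbatim
(same shadow shape), and `junk_excluded` below shows the junk witness `K = ⊤` fails the free-quotient
hypothesis of stub 2 / `levelStep`; no stub is an instance of a refuted statement.
`ledger negatives --problem SmoothPoincare4` = 0 (triage r1-1/2/3, 2026-08-16).
-/

noncomputable section

-- the prescribed namespace `Summit.<P>.<Sub>.…` duplicates `SmoothPoincare4` (P = Sub)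
set_option linter.dupNamespace false

namespace Summit.SmoothPoincare4.SmoothPoincare4.Cruxes.NilpotentShadowsStandard.JointLevineInclusionExclusion

open Literature.Topology.FourManifolds Subgroup
open Summit.SmoothPoincare4.SmoothPoincare4.Theses.CongruenceShadows
  (NilpotentShadowsStandard AbelianShadowStandard)

/-! ## 0. Notation -/

/-- `S m = S_{3+3m}`, the surface group at the route's genus. -/
abbrev S (m : ℕ) : Type := SurfaceGroup (3 + 3 * m)

/-- `N m = (N₀, N₁, N₂)`, the `m`-fold stabilised standard `S⁴` kernel triple (genus `3 + 3m`). -/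
abbrev N (m : ℕ) : TrisectionKernels (3 + 3 * m) := s4Kernels.stabilizeIter m

/-- `γ m c = γ_{c+2}(S)` (1-indexed lower central series; Mathlib's `(⊤).lowerCentralSeries (c+1)`):
level `c` = the shadow in `S/γ_{c+2}S`; level `0` = the abelian shadow. -/
abbrev γ (m c : ℕ) : Subgroup (S m) := (⊤ : Subgroup (S m)).lowerCentralSeries (c + 1)

/-- The level-`c` shadow of `K` is standard (inner clause of the crux; same shape as
`Disproof.ShadowStandardAt`). -/
def ShadowStandardAt (m : ℕ) (K : TrisectionKernels (3 + 3 * m)) (c : ℕ) : Prop :=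
  ∃ ψ : S m ≃* S m, ∀ i : Fin 3, (N m i ⊔ γ m c).map ψ.toMonoidHom = K i ⊔ γ m c

/-- Read-back (definitional): the crux is the conjunction over all levels. -/
theorem crux_iff :
    NilpotentShadowsStandard ↔
      ∀ (m : ℕ) (K : TrisectionKernels (3 + 3 * m)),
        IsGroupTrisection (3 + 3 * m) (m + 1) (PUnit : Type) K → ∀ c, ShadowStandardAt m K c :=
  Iff.rfl

/-- `φ` is INERT at level `c`: it acts trivially on `S/γ_{c+2}S` (`φ(x)x⁻¹ ∈ γ_{c+2}`), i.e. lies in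
the Johnson-filtration piece of `Aut S` whose Johnson image is the degree-`(c+1)` data
(`c = 0`: trivial on `H₁`, the Torelli group of `Σ_{g,*}` together with nothing else). -/
def Inert (m c : ℕ) (φ : S m ≃* S m) : Prop := ∀ x : S m, φ x * x⁻¹ ∈ γ m c

/-! ## 1. Sorry-free basics -/

/-- The standard triple is a `(3+3m, m+1)` group trisection of `{1}` (two discharged named facts). -/
theorem N_isGroupTrisection (m : ℕ) :
    IsGroupTrisection (3 + 3 * m) (m + 1) (PUnit : Type) (N m) := by
  induction m with
  | zero => exact s4Kernels_isGroupTrisection_holds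
  | succ m ih => exact stabilize_isGroupTrisection_holds _ _ _ _ ih

instance N_normal (m : ℕ) (i : Fin 3) : (N m i).Normal := (N_isGroupTrisection m).normal i

/-- An automorphism maps `⊤` onto `⊤`. -/
theorem map_top_equiv {m : ℕ} (ψ : S m ≃* S m) : (⊤ : Subgroup (S m)).map ψ.toMonoidHom = ⊤ := by
  rw [← MonoidHom.range_eq_map, MonoidHom.range_eq_top.2 ψ.surjective]

/-- `γ` is characteristic: automorphisms fix it. -/
theorem map_γ (m c : ℕ) (ψ : S m ≃* S m) : (γ m c).map ψ.toMonoidHom = γ m c := by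
  rw [Subgroup.map_lowerCentralSeries, map_top_equiv]

/-- `map` along a composite automorphism. -/
theorem map_trans {m : ℕ} (e₁ e₂ : S m ≃* S m) (K : Subgroup (S m)) :
    K.map (e₁.trans e₂).toMonoidHom = (K.map e₁.toMonoidHom).map e₂.toMonoidHom := by
  rw [Subgroup.map_map]; rfl

/-- `map` along `ψ.symm` then `ψ` is the identity. -/
theorem map_symm_map {m : ℕ} (ψ : S m ≃* S m) (K : Subgroup (S m)) :
    (K.map ψ.symm.toMonoidHom).map ψ.toMonoidHom = K := by
  rw [← map_trans, MulEquiv.symm_trans_self]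
  ext x
  simp

/-- `map` along `ψ` then `ψ.symm` is the identity. -/
theorem map_map_symm {m : ℕ} (ψ : S m ≃* S m) (K : Subgroup (S m)) :
    (K.map ψ.toMonoidHom).map ψ.symm.toMonoidHom = K := by
  rw [← map_trans, MulEquiv.self_trans_symm]
  ext x
  simp

/-- Transport of a normal-closure subgroup along an automorphism. -/
theorem map_normalClosure_eq {m : ℕ} (α : S m ≃* S m) (s : Set (S m)) :
    (normalClosure s).map α.toMonoidHom = normalClosure (α '' s) := by
  rw [Subgroup.map_normalClosure _ _ (by exact α.surjective)]
  rfl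

/-- The image of a subgroup as a set. -/
theorem image_coe_eq {m : ℕ} {α : S m ≃* S m} {K K' : Subgroup (S m)}
    (h : K.map α.toMonoidHom = K') : α '' (K : Set (S m)) = (K' : Set (S m)) := by
  rw [← h]
  rfl

/-- Freeness of a normal-closure quotient is transported along an automorphism. -/
theorem isFreeOfRank_transport {m k : ℕ} (α : S m ≃* S m) {s t : Set (S m)} (h : α '' s = t)
    (hs : IsFreeOfRank (S m ⧸ normalClosure s) k) : IsFreeOfRank (S m ⧸ normalClosure t) k := by
  refine hs.of_mulEquiv (QuotientGroup.congr (normalClosure s) (normalClosure t) α ?_)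
  change (normalClosure s).map α.toMonoidHom = normalClosure t
  rw [map_normalClosure_eq, h]

/-- For normal `P`, `⟪P⟫ = P`: the two spellings of the quotient agree. -/
theorem isFreeOfRank_quotient_iff {m k : ℕ} (P : Subgroup (S m)) [P.Normal] :
    IsFreeOfRank (S m ⧸ normalClosure (P : Set (S m))) k ↔ IsFreeOfRank (S m ⧸ P) k :=
  ⟨fun h => h.of_mulEquiv (QuotientGroup.quotientMulEquivOfEq (normalClosure_eq_self P)),
    fun h => h.of_mulEquiv (QuotientGroup.quotientMulEquivOfEq (normalClosure_eq_self P).symm)⟩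

/-- For normal `P, Q`, `⟪P ∪ Q⟫ = P ⊔ Q`. -/
theorem normalClosure_union_eq_sup {m : ℕ} (P Q : Subgroup (S m)) [P.Normal] [Q.Normal] :
    normalClosure ((P : Set (S m)) ∪ Q) = P ⊔ Q := by
  haveI : (P ⊔ Q).Normal := Subgroup.sup_normal P Q
  apply le_antisymm
  · exact normalClosure_le_normal (Set.union_subset (fun x hx => mem_sup_left hx)
      (fun x hx => mem_sup_right hx))
  · exact sup_le (fun x hx => subset_normalClosure (Or.inl hx))
      (fun x hx => subset_normalClosure (Or.inr hx))

/-- The pair quotient of a triple of NORMAL subgroups is the quotient by the join. -/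
theorem isFreeOfRank_pair_iff {m k : ℕ} (P Q : Subgroup (S m)) [P.Normal] [Q.Normal] :
    IsFreeOfRank (S m ⧸ normalClosure ((P : Set (S m)) ∪ Q)) k ↔
      IsFreeOfRank (S m ⧸ (P ⊔ Q)) k := by
  haveI : (P ⊔ Q).Normal := Subgroup.sup_normal P Q
  exact ⟨fun h => h.of_mulEquiv (QuotientGroup.quotientMulEquivOfEq (normalClosure_union_eq_sup P Q)),
    fun h => h.of_mulEquiv (QuotientGroup.quotientMulEquivOfEq (normalClosure_union_eq_sup P Q).symm)⟩

/-- `Xᵢ ⊔ γ = Yᵢ ⊔ γ` for `i, j` gives `Xᵢ ⊔ Xⱼ ⊔ γ = Yᵢ ⊔ Yⱼ ⊔ γ`. -/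
theorem sup_sup_congr_mod {m : ℕ} {Xi Xj Yi Yj M : Subgroup (S m)} (hi : Xi ⊔ M = Yi ⊔ M)
    (hj : Xj ⊔ M = Yj ⊔ M) : Xi ⊔ Xj ⊔ M = Yi ⊔ Yj ⊔ M := by
  rw [sup_sup_distrib_right Xi Xj M, hi, hj, ← sup_sup_distrib_right]

/-! ## 2. The three registered stubs -/

/-- **`stub_levelZero`** = the route's support item `AbelianShadowStandard` (stmt-SmoothPoincare4-14599,
difficulty M): the abelian (Lagrangian-triple) shadow of a `(3+3m, m+1)` group trisection of `{1}` is
standard — integral symplectic normal form of a Lagrangian triple with pairwise co-free sums of rank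
`m+1` and total sum `H`, plus `Aut S_g ↠ Sp±(2g, ℤ)`. The ONLY place where the triple quotient
(`PUnit`) enters the line (Disproof `anyGroup_false_of_genusThreeTrisectionOfCyclic`). Hand proof:
rattack evidence EVIDENCE.md §4 on the item (per Disproof.lean (c)). -/
theorem stub_levelZero : AbelianShadowStandard := by
  sorry

/-- STUB 2 statement at `(m, c)` — SINGLE LEVINE SURJECTIVITY FROM THE JOHNSON KERNEL (one handlebody).
If an honest handlebody kernel `Q` (`Q ⊴ S`, `S/Q ≅ F_g`) has the standard level-`c` shadow of `Nᵢ`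
(`Q·γ_{c+2} = Nᵢ·γ_{c+2}`), then its level-`(c+1)` shadow is realised from `Nᵢ` by an automorphism
INERT modulo `γ_{c+2}`. Levine coordinates: the level-`(c+1)` lifts of `Nᵢγ_{c+2}` form a torsor under
`Hom(Lᵢ, L_{c+2}(H/Lᵢ))` in which `Q·γ_{c+3}` is the point with Levine datum `d(Q) ∈ D_{c+1}(H/Lᵢ)`
(for `Q = α(Nᵢ)` this is `J^L_{c+1}(α)`, Levine arXiv:math/0408310 §3; for honest `Q` the same by
freeness of `S/Q`, Magnus–Witt — triage r1-1/2/3 torsor calculus, "no hidden depth"), and an inert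
`φ` translates the base point by `pᵢ(τ_{c+1}φ)` (Levine §4.1: `J^L|_J = p ∘ J`); so the stub says
`pᵢ(im τ_{c+1}) ⊇ {genuine single data}` — implied by the card's `ITJ_{c+1}`. Known: degree 1
(Johnson); odd degree `< g` (Levine Lemma 4.3, `D̃ = D`); degree 2 (Morita, Levine Rmk 4.1; triage
(C1) at `g = 3,6,9`); `g = 3` rationally through degree 8. OPEN: even degree `4 ≤ c+1 < g` up to
Levine's 2-primary index (his question after Rmk 4.1), and the core `c+1 ≥ g`. -/
def SingleJohnsonAt (m c : ℕ) : Prop :=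
  ∀ (i : Fin 3) (Q : Subgroup (S m)) [Q.Normal], IsFreeOfRank (S m ⧸ Q) (3 + 3 * m) →
    Q ⊔ γ m c = N m i ⊔ γ m c →
      ∃ φ : S m ≃* S m, Inert m c φ ∧ (N m i ⊔ γ m (c + 1)).map φ.toMonoidHom = Q ⊔ γ m (c + 1)

/-- STUB 2 at every genus and level. -/
def SingleJohnson : Prop := ∀ m c : ℕ, SingleJohnsonAt m c

/-- **`stub_singleJohnson`** (LOAD-BEARING together with stub 3; theorem-grade in odd degree `< g`,
research-grade in the open core). -/
theorem stub_singleJohnson : SingleJohnson := by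
  sorry

/-- STUB 3 statement at `(m, c)` — THE JOINT STEP (inclusion–exclusion gluing of inert realisers).
Three automorphisms `φ₀, φ₁, φ₂`, each inert modulo `γ_{c+2}`, such that for every pair the
level-`(c+1)` shadow of `(φᵢNᵢ, φⱼNⱼ)` is that of an honest rank-`(m+1)` kernel `P` (`P ⊴ S`,
`S/P ≅ F_{m+1}`, `P·γ' = φᵢ(Nᵢ)·φⱼ(Nⱼ)·γ'` — the level-`(c+1)` form of the pair axiom
`S/KᵢKⱼ ≅ F_{m+1}` = Levine-data compatibility on the common letter class `Lᵢ ∩ Lⱼ`, triage r1-2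
Common 1), are realised SIMULTANEOUSLY by one automorphism. Levine coordinates: for compatible data
`uᵢ ∈ pᵢ(im τ_{c+1})` there is ONE Johnson element `t` with `pᵢ(t) = uᵢ` for all `i`; lattice form
`⋂ᵢ (im τ + Zᵢ) = im τ + Z₀∩Z₁∩Z₂` on compatible triples (`Zᵢ = ker pᵢ` content-Boolean: triage
r1-3 `ContentDistributive`) — the card's inclusion–exclusion section `t = Σ sᵢ(uᵢ) − Σ mᵢⱼ` proves it
from `ITJ_{c+1}`; equivalently `Absorption_{c+1}` / `CRT(M_{c+1})` of the merged cards. At `m = 0` the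
compatibility hypothesis is vacuous above level 0 (`L_{c+2}(ℤ¹) = 0`). Same known range and open core
as stub 2. -/
def JointGlueAt (m c : ℕ) : Prop :=
  ∀ (φ : Fin 3 → S m ≃* S m), (∀ i, Inert m c (φ i)) →
    (∀ i j : Fin 3, i ≠ j → ∃ (P : Subgroup (S m)) (_ : P.Normal),
      IsFreeOfRank (S m ⧸ P) (m + 1) ∧
        P ⊔ γ m (c + 1) =
          (N m i).map (φ i).toMonoidHom ⊔ (N m j).map (φ j).toMonoidHom ⊔ γ m (c + 1)) →
    ∃ ψ : S m ≃* S m, ∀ i : Fin 3,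
      (N m i ⊔ γ m (c + 1)).map ψ.toMonoidHom = (N m i).map (φ i).toMonoidHom ⊔ γ m (c + 1)

/-- STUB 3 at every genus and level. -/
def JointGlue : Prop := ∀ m c : ℕ, JointGlueAt m c

/-- **`stub_jointGlue`** (LOAD-BEARING: the only place where the three handlebodies interact;
research-grade in the open core, theorem-grade where `ITJ_{c+1}` is known). -/
theorem stub_jointGlue : JointGlue := by
  sorry

/-! ## 3. Composition (sorry-free glue): the three stubs prove the crux BY NAME -/

/-- Iso-transport of the level-`c` statement: if `ψ` standardises level `c` of `K`, then
`K' = ψ⁻¹K` has level `c` standard ON THE NOSE. -/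
theorem onTheNose_of_shadow {m c : ℕ} {K : TrisectionKernels (3 + 3 * m)} {ψ : S m ≃* S m}
    (hψ : ∀ i : Fin 3, (N m i ⊔ γ m c).map ψ.toMonoidHom = K i ⊔ γ m c) (i : Fin 3) :
    (K i).map ψ.symm.toMonoidHom ⊔ γ m c = N m i ⊔ γ m c := by
  have h := congrArg (Subgroup.map ψ.symm.toMonoidHom) (hψ i)
  rw [map_map_symm, Subgroup.map_sup, map_γ] at h
  exact h.symm

/-- **THE LEVEL STEP** (`c ↦ c+1`) from stubs 2 and 3, for any kernel triple with normal members, free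
single quotients of rank `g` and free pair quotients of rank `m+1` (no triple condition, no `PUnit`:
nilpotent Nakayama). This is where `IsGroupTrisection.normal` / `free_quotient` / `free_pairQuotient`
are consumed (Disproof `_false_without_trisection`). -/
theorem levelStep {m c : ℕ} (hS : SingleJohnsonAt m c) (hJ : JointGlueAt m c)
    (K : TrisectionKernels (3 + 3 * m)) (hn : ∀ i, (K i).Normal)
    (hfree : ∀ i, IsFreeOfRank (S m ⧸ normalClosure (K i : Set (S m))) (3 + 3 * m))
    (hpair : ∀ i j : Fin 3, i ≠ j → IsFreeOfRank (K.pairQuotient i j) (m + 1))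
    (hc : ShadowStandardAt m K c) : ShadowStandardAt m K (c + 1) := by
  obtain ⟨ψ, hψ⟩ := hc
  -- transport: K' = ψ⁻¹ K has level c standard on the nose
  set K' : TrisectionKernels (3 + 3 * m) := fun i => (K i).map ψ.symm.toMonoidHom with hK'
  have hn' : ∀ i, (K' i).Normal := fun i => Subgroup.Normal.map (hn i) _ ψ.symm.surjective
  have hnose : ∀ i, K' i ⊔ γ m c = N m i ⊔ γ m c := fun i => onTheNose_of_shadow hψ i
  have hfree' : ∀ i, IsFreeOfRank (S m ⧸ normalClosure (K' i : Set (S m))) (3 + 3 * m) := fun i =>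
    isFreeOfRank_transport ψ.symm (image_coe_eq rfl) (hfree i)
  have hpair' : ∀ i j : Fin 3, i ≠ j →
      IsFreeOfRank (S m ⧸ normalClosure ((K' i : Set (S m)) ∪ K' j)) (m + 1) := by
    intro i j hij
    refine isFreeOfRank_transport ψ.symm ?_ (hpair i j hij)
    rw [Set.image_union, image_coe_eq rfl, image_coe_eq rfl]
  -- stub 2: inert single realisers of the next level, one handlebody at a time
  have hφ : ∀ i, ∃ φ : S m ≃* S m, Inert m c φ ∧
      (N m i ⊔ γ m (c + 1)).map φ.toMonoidHom = K' i ⊔ γ m (c + 1) := by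
    intro i
    haveI := hn' i
    exact hS i (K' i) ((isFreeOfRank_quotient_iff _).1 (hfree' i)) (hnose i)
  choose φ hφI hφ using hφ
  have hφ' : ∀ i, (N m i).map (φ i).toMonoidHom ⊔ γ m (c + 1) = K' i ⊔ γ m (c + 1) := by
    intro i
    rw [← hφ i, Subgroup.map_sup, map_γ]
  -- compatibility: the pairs are shadows of the honest rank-(m+1) kernels K'ᵢ ⊔ K'ⱼ
  have hP : ∀ i j : Fin 3, i ≠ j → ∃ (P : Subgroup (S m)) (_ : P.Normal),
      IsFreeOfRank (S m ⧸ P) (m + 1) ∧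
        P ⊔ γ m (c + 1) =
          (N m i).map (φ i).toMonoidHom ⊔ (N m j).map (φ j).toMonoidHom ⊔ γ m (c + 1) := by
    intro i j hij
    haveI := hn' i
    haveI := hn' j
    haveI hPn : (K' i ⊔ K' j).Normal := Subgroup.sup_normal _ _
    exact ⟨K' i ⊔ K' j, hPn, (isFreeOfRank_pair_iff _ _).1 (hpair' i j hij),
      (sup_sup_congr_mod (hφ' i) (hφ' j)).symm⟩
  -- stub 3: glue
  obtain ⟨ψ', hψ'⟩ := hJ φ hφI hP
  refine ⟨ψ'.trans ψ, fun i => ?_⟩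
  rw [map_trans, hψ' i, hφ' i, Subgroup.map_sup, map_γ, hK', map_symm_map]

/-- All levels, for one group trisection of `{1}`: level `0` by stub 1, the step by `levelStep`. -/
theorem shadowStandardAt_of_stubs (h0 : AbelianShadowStandard) (hS : SingleJohnson) (hJ : JointGlue)
    (m : ℕ) (K : TrisectionKernels (3 + 3 * m))
    (hK : IsGroupTrisection (3 + 3 * m) (m + 1) (PUnit : Type) K) : ∀ c, ShadowStandardAt m K c
  | 0 => h0 m K hK
  | c + 1 => levelStep (hS m c) (hJ m c) K hK.normal hK.free_quotient hK.free_pairQuotient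
      (shadowStandardAt_of_stubs h0 hS hJ m K hK c)

/-- The glue at all genera and levels (conclusion spelled level-wise; `crux_iff`). -/
theorem nilpotentShadowsStandard_of_stubs (h0 : AbelianShadowStandard) (hS : SingleJohnson)
    (hJ : JointGlue) :
    ∀ (m : ℕ) (K : TrisectionKernels (3 + 3 * m)),
      IsGroupTrisection (3 + 3 * m) (m + 1) (PUnit : Type) K → ∀ c, ShadowStandardAt m K c :=
  fun m K hK => shadowStandardAt_of_stubs h0 hS hJ m K hK

/-- **Composition.** The three stubs prove the crux `CongruenceShadows.NilpotentShadowsStandard` BY NAME. -/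
theorem NilpotentShadowsStandard_of :
    _root_.Summit.SmoothPoincare4.SmoothPoincare4.Theses.CongruenceShadows.NilpotentShadowsStandard :=
  nilpotentShadowsStandard_of_stubs stub_levelZero stub_singleJohnson stub_jointGlue

/-! ## 4. Certificates (sorry-free): consistency of the cut -/

/-- Stub 2 is not vacuous and has the right shape at the base point: `Q = Nᵢ` is realised by the
inert `φ = 1`. -/
theorem singleJohnsonAt_base (m c : ℕ) (i : Fin 3) :
    ∃ φ : S m ≃* S m, Inert m c φ ∧
      (N m i ⊔ γ m (c + 1)).map φ.toMonoidHom = N m i ⊔ γ m (c + 1) := by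
  refine ⟨MulEquiv.refl _, fun x => by simp [one_mem], ?_⟩
  ext x; simp

/-- Inert automorphisms preserve every level-`c` shadow (they fix `S/γ_{c+2}` pointwise). -/
theorem map_sup_γ_of_inert {m c : ℕ} {φ : S m ≃* S m} (hφ : Inert m c φ) (K : Subgroup (S m)) :
    K.map φ.toMonoidHom ⊔ γ m c = K ⊔ γ m c := by
  apply le_antisymm
  · refine sup_le ?_ le_sup_right
    rintro _ ⟨s, hs, rfl⟩
    have : φ s = (φ s * s⁻¹) * s := by group
    rw [MulEquiv.coe_toMonoidHom, this]
    exact mul_mem (mem_sup_right (hφ s)) (mem_sup_left hs)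
  · refine sup_le ?_ le_sup_right
    intro s hs
    have : s = (φ s * s⁻¹)⁻¹ * φ s := by group
    rw [this]
    exact mul_mem (mem_sup_right (inv_mem (hφ s))) (mem_sup_left ⟨s, hs, rfl⟩)

/-- CONSISTENCY OF THE CUT: the conclusion of stub 2 forces its level-`c` hypothesis (an inert realiser
of level `c+1` exists only over a standard level `c`), so stub 2 asks for inert realisers exactly where
they can exist; and the data handed to stub 3 (`φᵢ(Nᵢ) ⊔ γ'`, `φᵢ` inert) are level-`c`-standard on the
nose (`inert_image_onTheNose`) — the two stubs speak about the SAME torsor of lifts. -/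
theorem singleJohnson_hypothesis_necessary {m c : ℕ} {i : Fin 3} {Q : Subgroup (S m)} {φ : S m ≃* S m}
    (hφ : Inert m c φ) (h : (N m i ⊔ γ m (c + 1)).map φ.toMonoidHom = Q ⊔ γ m (c + 1)) :
    Q ⊔ γ m c = N m i ⊔ γ m c := by
  have hle : γ m (c + 1) ≤ γ m c :=
    Subgroup.lowerCentralSeries_antitone ⊤ (Nat.le_succ (c + 1))
  have e1 : Q ⊔ γ m c = (Q ⊔ γ m (c + 1)) ⊔ γ m c := by
    rw [sup_assoc, sup_eq_right.2 hle]
  rw [e1, ← h, Subgroup.map_sup, map_γ, sup_assoc, sup_eq_right.2 hle, map_sup_γ_of_inert hφ]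

/-- The level-`(c+1)` images under inert automorphisms are level-`c`-standard on the nose (read-back
for stub 3's data). -/
theorem inert_image_onTheNose {m c : ℕ} {φ : S m ≃* S m} (hφ : Inert m c φ) (i : Fin 3) :
    (N m i).map φ.toMonoidHom ⊔ γ m c = N m i ⊔ γ m c :=
  map_sup_γ_of_inert hφ (N m i)

/-- CHECK AGAINST THE LANDED NEGATIVE LEMMA `Theorems/NilpotentShadowsStandard/Negative/LoadBearing.lean`
(`nilpotentShadowsStandard_false_without_trisection`, junk witness `K = ⊤`): the junk kernel `⊤` is NOT
an honest handlebody kernel (`S/⊤` is trivial, not free of rank `g ≥ 3`), so it never enters stub 2 or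
`levelStep` — the skeleton consumes `free_quotient` exactly where the disprover showed it must. -/
theorem junk_excluded (m : ℕ) :
    ¬ IsFreeOfRank (S m ⧸ normalClosure ((⊤ : Subgroup (S m)) : Set (S m))) (3 + 3 * m) := by
  rintro ⟨e⟩
  have h1 : ∀ q : S m ⧸ normalClosure ((⊤ : Subgroup (S m)) : Set (S m)), q = 1 := by
    intro q
    obtain ⟨x, rfl⟩ := QuotientGroup.mk_surjective q
    exact (QuotientGroup.eq_one_iff x).2 (subset_normalClosure (Subgroup.mem_top x))
  have h01 : (FreeGroup.of (⟨0, by omega⟩ : Fin (3 + 3 * m)) : FreeGroup (Fin (3 + 3 * m))) = 1 :=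
    e.injective (by rw [h1 (e _), h1 (e 1)])
  exact FreeGroup.of_ne_one _ h01

end Summit.SmoothPoincare4.SmoothPoincare4.Cruxes.NilpotentShadowsStandard.JointLevineInclusionExclusion

end
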